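import Summits.BirchSwinnertonDyer.BirchSwinnertonDyer.Theorems.SignedLowerHalvesSprungLowerDivisibilityAtThreeIotaDoorContraClosed
import Summits.BirchSwinnertonDyer.BirchSwinnertonDyer.Theorems.SignedLowerHalvesSprungLowerDivisibilityAtThreeCokerBoundByMassOfThm714
import HarnessLib

/-!
# Crux `SprungLowerDivisibilityAtThree` (item stmt-BirchSwinnertonDyer-19875), line `chromatic-common-zeros`: THE ι-DOORS OF THE BORN TWIN CRUXES
# K′ = `PrintX8VSC.KatoFineLowerSporadicGivenHeldX8Contra` (item 23732) / C′ = `PrintX8VSC.CyclotomicLowerPosLevelGivenHeldX8Contra` (item 23733)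
# from THEIR guard: the held pack `HeldFactsIotaDoorX8Contra` (item 23731: PT functional model ∧ Kato 12.4 ∧ Matar 1.1) + Sprung Thm 7.14

Cell `bsd-ssimc` (host), LEAD seat `cruxlead-stmt-BirchSwinnertonDyer-19875` (gen 7); theorems only (no `def`, no named fact, no instance); closes
NO item. Companion (part 2) of `…IotaDoorContraClosed.lean` (LEAD g7 p674090), written after the BIRTH of `route-BirchSwinnertonDyer-PrintX8VSC`
(rev 2, 2026-08-28T22:3xZ; director-bsd (288)(a)): the born guard's pack has NO Kato fine-torsion conjunct (ref R-287 turnkey: on X8 the fine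
dual's torsion follows from Thm 7.14, w2 g10 `fineSelmerDualData_isTorsion_inv_of_thm714` / w3 g9 p669279), so the doors are re-derived from
{PT, Kato 12.4, Matar} + the guard's `h714` through w2 g10's `cokerBoundIotaOffT_contra_of_poitouTate_of_thm714` (p671990/p672134). These two
theorems ARE the door decls of the line skeletons REGISTERED by the LEAD on 23732 / 23733 (`ledger skeleton check` OK 22:4xZ; tree copies
`Cruxes/SprungLowerDivisibilityAtThree/Lines/twinC_{K,C}prime_iota_door_contra_LEADg7.lean`), each of which has exactly ONE stub left — the research
residue (K′: Kato 12.10 ⊆ at the sporadic ι-orbits with `j(ι𝔭) < k(𝔭)`; C′: Sprung 7.21 ⊆ at the positive-level cyclotomic common zeros with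
`j(𝔭) < k(𝔭)`), OPEN in print at `(3, a₃ = ±3)`. HONEST FRAMING: compositions of landed lemmas; the inputs are PUBLISHED theorems typed
statement-only, displayed as hypotheses, never discharged; K′, C′, K1, leaf X8 and BSD are NOT proved.

* §1 `iotaDoorContra_sporadic_of_heldPack_of_thm714 (hPT) (h124) (hMatar) (h714)` — K′'s door (sporadic `𝔭`, door `k(𝔭) ≤ j(ι𝔭)`).
* §2 `iotaDoorContra_posLevel_of_heldPack_of_thm714 (hPT) (h124) (hMatar) (h714)` — C′'s K-form door (`T ∉ 𝔭 ∋ Φ_{3^j}(1+T)`, `ι𝔭 = 𝔭`).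

References: [Kato2004Asterisque] Thm. 12.4 (p. 221), Conj. 12.10 (p. 224), (17.13.1) (p. 279–280); [Sprung2012] Thm. 7.14 (3) (p. 1504), Prop. 7.19,
Main Conj. 7.21 (p. 1505); [Matar2020] Thm. 1.1; [Wingberg1989] Cor. 2.5; [Kobayashi2003] Prop. 7.1, Thm. 7.3.
-/

set_option linter.dupNamespace false
set_option autoImplicit false

noncomputable section

open scoped Classical NumberField MatrixGroups ModularForm

open NumberField IsDedekindDomain CongruenceSubgroup WeierstrassCurve Field
  Literature.NumberTheory.EllipticCurves Literature.NumberTheory.EllipticCurves.ModularForms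
  Literature.NumberTheory.EllipticCurves.ZpExtension Literature.NumberTheory.EllipticCurves.Sprung2017
  Literature.NumberTheory.EllipticCurves.Sprung2012 Literature.NumberTheory.EllipticCurves.Rank1Residual
  Literature.NumberTheory.EllipticCurves.IwasawaAlgebra Literature.NumberTheory.EllipticCurves.Kato2004
  Literature.NumberTheory.EllipticCurves.Module
  Summit.BirchSwinnertonDyer.BirchSwinnertonDyer.Theorems

namespace Summit.BirchSwinnertonDyer.BirchSwinnertonDyer.Theorems.ChromaticCommonZeros

/-! ### §1 K′'s door from the born guard -/

/-- **THE ι-DOOR IN PRINT CURRENCY, PROVED** from the held pack's three inputs (Sprung (3)/(7.18)∞ Poitou–Tate functional model, Kato Thm 12.4,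
Matar 2020 Thm 1.1) and the guard's Sprung Thm 7.14 (`h714`, supplying the fine dual's torsion on X8): at a sporadic height-one `𝔭` (`p ∉ 𝔭`, no `ω̃ₙ ∈ 𝔭`), common zero of both normalised colours,
INSIDE the door `ℓ_𝔭(I.H ⧸ Cs.Z) ≤ min_• ℓ_{ι𝔭}(Λ ⧸ range C•.colMap)`, Kato's fine inequality `ℓ_𝔭(I.H ⧸ Cs.Z) ≤ ℓ_𝔭 Y′.X` holds for the
natural-keyed `Y′ : FineSelmerDualData κ γ⁻¹`. Proof: the mirror prime `ι𝔭` is height one with `p, T ∉ ι𝔭`; if `ι𝔭` is a common zero,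
the Contra F-α♮ telescope at `ι𝔭` (`ChromaticCommonZeros.cokerBoundIotaOffT_contra_of_poitouTate_of_thm714`, w2 g10) gives
`j(ι𝔭) ≤ x′(ιι𝔭) = x′(𝔭)`; otherwise `j(ι𝔭) = 0`; either way `ChromaticCommonZeros.katoFineLowerAt_of_iotaDoor_contra` (w3 g9 p670914).
[cite: Kato2004Asterisque, Thm. 12.4 (p. 221), (17.13.1) (p. 279–280)] [cite: Sprung2012, Thm. 7.14 (3) (p. 1504)] [cite: Matar2020, Thm. 1.1]
[cite: Kobayashi2003, Prop. 7.1, Thm. 7.3 (pp. 12–13)] [cite: Wingberg1989, Cor. 2.5] -/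
theorem iotaDoorContra_sporadic_of_heldPack_of_thm714 (hPT : thm714seq_sharpFlat_poitouTate_functionalModel) (h124 : Kato2004.thm12_4)
    (hMatar : matar2020_thm11_selmerDualTorsion_pseudoIso_fineSelmerDual) (h714 : thm714_sharpFlatSelmerDual_finite_torsion) :
    ∀ (W : WeierstrassCurve ℚ) [W.IsElliptic] [W.IsGloballyMinimal] (p : ℕ) [Fact p.Prime]
      [ContinuousSMul ℤ_[p] (W.tateModule p)] [Module.Free ℤ_[p] (W.tateModule p)]
      [Module.Finite ℤ_[p] (W.tateModule p)],
      ClassX8 W p → ∀ (κ : ZpExtension ℚ p) (γ : Field.absoluteGaloisGroup ℚ),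
      κ.IsCyclotomic → κ.IsTopGenerator γ → IsCyclotomicVariable p γ →
    ∀ (v : HeightOneSpectrum (𝓞 ℚ)), (p : 𝓞 ℚ) ∈ v.asIdeal →
    ∀ (g : Field.absoluteGaloisGroup (v.adicCompletion ℚ)),
      κ.IsTopGenerator (resGalOfEmb (closureEmb (K := ℚ) (v.adicCompletion ℚ)) g) →
    ∀ (cneg : localPoints W (v.adicCompletion ℚ)) (c : ℕ → localPoints W (v.adicCompletion ℚ)),
      IsHondaSystem κ (closureEmb (K := ℚ) (v.adicCompletion ℚ)) W (W.frobeniusTrace p) g cneg c →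
    ∀ (N : ℕ) (_ : NeZero N) (f : CuspForm (Gamma0 N) 2) (ϖ : ℚ) (Lsharp Lflat : IwasawaAlgebra p),
      IsNewformOf W f → (ϖ : ℝ) * W.realPeriodRat = plusPeriod f →
      IsSprungPair f p (W.frobeniusTrace p) Lsharp Lflat →
    ∀ (I : Kato2004.IwasawaH1Data W p κ γ)
      (Cs : SharpFlatColemanKatoDataContra W p f ϖ κ γ (closureEmb (K := ℚ) (v.adicCompletion ℚ))
        (W.frobeniusTrace p) g c Chroma.sharp I)
      (Cf : SharpFlatColemanKatoDataContra W p f ϖ κ γ (closureEmb (K := ℚ) (v.adicCompletion ℚ))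
        (W.frobeniusTrace p) g c Chroma.flat I),
      Cs.Z = Cf.Z →
    ∀ (Y : W.FineSelmerDualData κ γ⁻¹) (𝔭 : PrimeSpectrum (IwasawaAlgebra p)), 𝔭.asIdeal.height = 1 →
      (p : IwasawaAlgebra p) ∉ 𝔭.asIdeal →
      (¬ ∃ n : ℕ, ((cyclotomicOmega p n).map (Int.castRingHom ℤ_[p]) : PowerSeries ℤ_[p]) ∈ 𝔭.asIdeal) →
      (∀ (col' : Chroma) (G' : IwasawaAlgebra p),
        iwasawaToPowerSeries p G' =
          PowerSeries.C (ϖ : ℚ_[p]) * iwasawaToPowerSeries p (chromaticL col' Lsharp Lflat) →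
        G' ∈ 𝔭.asIdeal) →
      Module.lengthAt (IwasawaAlgebra p) (I.H ⧸ Cs.Z) 𝔭 ≤
          min (Module.lengthAt (IwasawaAlgebra p) (IwasawaAlgebra p ⧸ LinearMap.range Cs.colMap)
                (PrimeSpectrum.comap (invol p).toRingHom 𝔭))
            (Module.lengthAt (IwasawaAlgebra p) (IwasawaAlgebra p ⧸ LinearMap.range Cf.colMap)
                (PrimeSpectrum.comap (invol p).toRingHom 𝔭)) →
      Module.lengthAt (IwasawaAlgebra p) (I.H ⧸ Cs.Z) 𝔭 ≤ Module.lengthAt (IwasawaAlgebra p) Y.X 𝔭 := by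
  intro W _ _ p _ _ _ _ hX κ γ hκ hγ hcv v hv g hg cneg c hH N hN f ϖ Lsharp Lflat hf hϖ hSP I Cs Cf hZ Y 𝔭 h𝔭 hp𝔭
    hspor hcommon hdoor
  haveI : NeZero N := hN
  -- `T ∉ 𝔭` (sporadic: `ω̃₀ = T`)
  have hT : (PowerSeries.X : IwasawaAlgebra p) ∉ 𝔭.asIdeal := fun hT =>
    hspor ⟨0, by rwa [ChromaticCommonZeros.coe_map_cyclotomicOmega_zero]⟩
  -- the mirror prime `ι𝔭`: height one, `p ∉ ι𝔭`, `T ∉ ι𝔭`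
  obtain ⟨h𝔮, hp𝔮⟩ := ChromaticCommonZeros.comap_invol_heightOne_not_mem 𝔭 h𝔭 hp𝔭
  have hT𝔮 := ChromaticCommonZeros.X_not_mem_comap_invol 𝔭 hT
  have hs : chromaticL Chroma.sharp Lsharp Lflat ≠ 0 :=
    ChromaticBothColours.ClassX8.chromaticL_ne_zero W p hX f Lsharp Lflat hf hSP Chroma.sharp
  have hfl : chromaticL Chroma.flat Lsharp Lflat ≠ 0 :=
    ChromaticBothColours.ClassX8.chromaticL_ne_zero W p hX f Lsharp Lflat hf hSP Chroma.flat
  refine ChromaticCommonZeros.katoFineLowerAt_of_iotaDoor_contra W p Cs Cf (ClassX8.irr' W p hX) hSP hs hfl Y 𝔭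
    (PrimeSpectrum.comap (invol p).toRingHom 𝔭) h𝔮 ?_ hdoor
  intro hcommon𝔮
  have h := ChromaticCommonZeros.cokerBoundIotaOffT_contra_of_poitouTate_of_thm714 hPT h124 hMatar h714 W p hX κ γ hκ hγ
    hcv v hv g hg cneg c hH N hN f ϖ Lsharp Lflat hf hϖ hSP I Cs Cf hZ Y (PrimeSpectrum.comap (invol p).toRingHom 𝔭)
    h𝔮 hp𝔮 hT𝔮 hcommon𝔮
  rwa [Kato2004.comap_invol_comap_invol] at h

/-! ### §2 C′'s K-form door from the born guard -/

/-- **THE K-FORM DOOR AT A POSITIVE-LEVEL CYCLOTOMIC PRIME, from the held pack's three inputs and the guard's Thm 7.14** (PT functional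
model, Kato 12.4, Matar 1.1; `h714` supplies the fine dual's torsion on X8): over the same binders as the
residue stub, at a height-one `𝔭` with `T ∉ 𝔭 ∋ Φ_{3^j}(1+T)` (`j ≥ 1`), common zero of both normalised colours, INSIDE the door
`ℓ_𝔭(I.H ⧸ Cs.Z) ≤ min_• ℓ_𝔭(Λ ⧸ range C•.colMap)`: `ℓ_𝔭(I.H ⧸ Cs.Z) ≤ ℓ_𝔭 Y′.X`. Proof: `𝔭` is `ι`-fixed and `3 ∉ 𝔭`; the Contra F-α♮
telescope at `𝔭` (`ChromaticCommonZeros.cokerBoundIotaOffT_contra_of_poitouTate_of_thm714`, w2 g10) reads `j(𝔭) ≤ x′(ι𝔭) = x′(𝔭)`;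
compose (`ChromaticCommonZeros.katoFineLowerAt_of_iotaDoor_contra_of_comap_invol_eq`, w3 g9 p670914).
[cite: Kato2004Asterisque, Thm. 12.4 (p. 221), (17.13.1) (p. 279–280)] [cite: Sprung2012, Thm. 7.14 (3) (p. 1504)] [cite: Matar2020, Thm. 1.1]
[cite: Kobayashi2003, Prop. 7.1, Thm. 7.3 (pp. 12–13)] [cite: Wingberg1989, Cor. 2.5] -/
theorem iotaDoorContra_posLevel_of_heldPack_of_thm714 (hPT : thm714seq_sharpFlat_poitouTate_functionalModel) (h124 : Kato2004.thm12_4)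
    (hMatar : matar2020_thm11_selmerDualTorsion_pseudoIso_fineSelmerDual) (h714 : thm714_sharpFlatSelmerDual_finite_torsion) :
    ∀ (W : WeierstrassCurve ℚ) [W.IsElliptic] [W.IsGloballyMinimal] (p : ℕ) [Fact p.Prime]
      [ContinuousSMul ℤ_[p] (W.tateModule p)] [Module.Free ℤ_[p] (W.tateModule p)]
      [Module.Finite ℤ_[p] (W.tateModule p)],
      ClassX8 W p → ∀ (κ : ZpExtension ℚ p) (γ : Field.absoluteGaloisGroup ℚ),
      κ.IsCyclotomic → κ.IsTopGenerator γ → IsCyclotomicVariable p γ →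
    ∀ (v : HeightOneSpectrum (𝓞 ℚ)), (p : 𝓞 ℚ) ∈ v.asIdeal →
    ∀ (g : Field.absoluteGaloisGroup (v.adicCompletion ℚ)),
      κ.IsTopGenerator (resGalOfEmb (closureEmb (K := ℚ) (v.adicCompletion ℚ)) g) →
    ∀ (cneg : localPoints W (v.adicCompletion ℚ)) (c : ℕ → localPoints W (v.adicCompletion ℚ)),
      IsHondaSystem κ (closureEmb (K := ℚ) (v.adicCompletion ℚ)) W (W.frobeniusTrace p) g cneg c →
    ∀ (N : ℕ) (_ : NeZero N) (f : CuspForm (Gamma0 N) 2) (ϖ : ℚ) (Lsharp Lflat : IwasawaAlgebra p),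
      IsNewformOf W f → (ϖ : ℝ) * W.realPeriodRat = plusPeriod f →
      IsSprungPair f p (W.frobeniusTrace p) Lsharp Lflat →
    ∀ (I : Kato2004.IwasawaH1Data W p κ γ)
      (Cs : SharpFlatColemanKatoDataContra W p f ϖ κ γ (closureEmb (K := ℚ) (v.adicCompletion ℚ))
        (W.frobeniusTrace p) g c Chroma.sharp I)
      (Cf : SharpFlatColemanKatoDataContra W p f ϖ κ γ (closureEmb (K := ℚ) (v.adicCompletion ℚ))
        (W.frobeniusTrace p) g c Chroma.flat I),
      Cs.Z = Cf.Z →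
    ∀ (Y : W.FineSelmerDualData κ γ⁻¹) (𝔭 : PrimeSpectrum (IwasawaAlgebra p)), 𝔭.asIdeal.height = 1 →
      (PowerSeries.X : IwasawaAlgebra p) ∉ 𝔭.asIdeal →
      (∃ j : ℕ, 1 ≤ j ∧
        ((((Polynomial.cyclotomic (p ^ j) ℤ).comp (Polynomial.X + 1)).map (Int.castRingHom ℤ_[p]) : Polynomial ℤ_[p]) :
          PowerSeries ℤ_[p]) ∈ 𝔭.asIdeal) →
      (∀ (col' : Chroma) (G' : IwasawaAlgebra p),
        iwasawaToPowerSeries p G' =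
          PowerSeries.C (ϖ : ℚ_[p]) * iwasawaToPowerSeries p (chromaticL col' Lsharp Lflat) →
        G' ∈ 𝔭.asIdeal) →
      Module.lengthAt (IwasawaAlgebra p) (I.H ⧸ Cs.Z) 𝔭 ≤
          min (Module.lengthAt (IwasawaAlgebra p) (IwasawaAlgebra p ⧸ LinearMap.range Cs.colMap) 𝔭)
            (Module.lengthAt (IwasawaAlgebra p) (IwasawaAlgebra p ⧸ LinearMap.range Cf.colMap) 𝔭) →
      Module.lengthAt (IwasawaAlgebra p) (I.H ⧸ Cs.Z) 𝔭 ≤ Module.lengthAt (IwasawaAlgebra p) Y.X 𝔭 := by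
  intro W _ _ p _ _ _ _ hX κ γ hκ hγ hcv v hv g hg cneg c hH N hN f ϖ Lsharp Lflat hf hϖ hSP I Cs Cf hZ Y 𝔭 h𝔭 hT hΦ
    hcommon hdoor
  haveI : NeZero N := hN
  obtain ⟨j, hj1, hΦj⟩ := hΦ
  have hp3 : p = 3 := hX.1
  subst hp3
  -- `3 ∉ 𝔭` and `ι𝔭 = 𝔭` at a positive-level cyclotomic prime
  have hp𝔭 : ((3 : ℕ) : IwasawaAlgebra 3) ∉ 𝔭.asIdeal :=
    ChromaticCommonZeros.natCast_not_mem_of_cyclotomic_comp_mem 𝔭 h𝔭 hj1 hΦj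
  have hfix : PrimeSpectrum.comap (invol 3).toRingHom 𝔭 = 𝔭 :=
    ChromaticCommonZeros.comap_invol_eq_self_of_cyclotomic_comp_mem 𝔭 h𝔭 hj1 hΦj
  have hs : chromaticL Chroma.sharp Lsharp Lflat ≠ 0 :=
    ChromaticBothColours.ClassX8.chromaticL_ne_zero W 3 hX f Lsharp Lflat hf hSP Chroma.sharp
  have hfl : chromaticL Chroma.flat Lsharp Lflat ≠ 0 :=
    ChromaticBothColours.ClassX8.chromaticL_ne_zero W 3 hX f Lsharp Lflat hf hSP Chroma.flat
  refine ChromaticCommonZeros.katoFineLowerAt_of_iotaDoor_contra_of_comap_invol_eq W 3 Cs Cf (ClassX8.irr' W 3 hX) hSP hs hfl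
    Y 𝔭 h𝔭 hfix ?_ hdoor
  intro hcommon'
  exact ChromaticCommonZeros.cokerBoundIotaOffT_contra_of_poitouTate_of_thm714 hPT h124 hMatar h714 W 3 hX κ γ hκ hγ hcv v hv
    g hg cneg c hH N hN f ϖ Lsharp Lflat hf hϖ hSP I Cs Cf hZ Y 𝔭 h𝔭 hp𝔭 hT hcommon'

end Summit.BirchSwinnertonDyer.BirchSwinnertonDyer.Theorems.ChromaticCommonZeros

end
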